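import Summits.BirchSwinnertonDyer.BirchSwinnertonDyer.Theorems.KolyvaginDepthDoorDepthTableKuriharaDecisivePrime
import Summits.BirchSwinnertonDyer.BirchSwinnertonDyer.Theorems.KolyvaginDepthDoorDepthTableKuriharaSocket794a1
import Summits.BirchSwinnertonDyer.Rank1Residual.Supersingular.CountPointsFast
import Literature.NumberTheory.EllipticCurves.BSDSelmerPConverseSerreProofs
import HarnessLib

/-!
# Route `KolyvaginDepthDoor`, crux `KolyvaginDepthSupplyKN` (stmt-BirchSwinnertonDyer-22820) —
# DEPTH TABLE v19, ROW `794a1` @ `(7, d_K = -23)`: THE DECISIVE PRIME `ℓ★ = 197` IN SELMER-BOUND FORM — the twist Selmer bound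
# `#Sel_7(E^{(-23)}) ≤ 7` FORCES a unit mod-`7` Kurihara number of `T₀ = [1, 0, 1, -1334, -30036]` AT `197` (kernel: `30 • P̄ ≠ O` in
# `T̃₀(𝔽_197)` for `P = (102, 896)`, `#T̃₀(𝔽_197) = 210 = 7·30`)

Helper file of the lead prover of line `levelone` (kdd-p1 g23; `--supports stmt-BirchSwinnertonDyer-22820
--as helper`); it closes nothing and BSD is NOT proved by it. Variant of `…KuriharaDecisive709a1` for a row WITHOUT an exact reading in
the tree (`rank 794a1 = 2` is not yet a kernel theorem): instead of «bit ⟺ unit at ℓ★» the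
file states the Selmer-bound form «`#Sel_7(E^{(d_K)}) ≤ 7` ⟹ unit `δ̃_197(T₀)`» (generic `twistKuriharaClaim_prime_of_natCard_selmerGroup_le`,
Sakamoto 2022 L4.4 + L4.6 (1) BY NAME `hSak3`; the local `7`-indivisibility of `P` at `197` KERNEL-CHECKED by the addition chain and
`localNondivisible_of_chainB`). READING: a computed ZERO `δ̃_197(T₀) ≡ 0 (mod 7)` certifies `#Sel_7(E^{(-23)}/ℚ) > 7` modulo print —
which kills the depth-ONE bit of this row at `(7, ℚ(√-23))` (the bit needs `#Sel_7(twist) ≤ 7`) and contradicts BSD's `Ш(T₀)_an = 1`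
for this rank-one twist; a UNIT closes the row through `…KuriharaSocket794a1`. Per curve; nothing class-wide; BSD is NOT proved by it.

References: [Sakamoto2022pSelmer] Lemma 4.4, Lemma 4.6 (1); [Kim2022StructureSelmer] §1.2.2; [SilvermanAEC2009] III.2.3, VII.2.1, VII.3.1,
X.5 Cor. 5.4; [CremonaAlgorithms1997] Table 1 (794a1).
-/

set_option linter.dupNamespace false

noncomputable section

open scoped Classical NumberField

namespace Summit.BirchSwinnertonDyer.BirchSwinnertonDyer.Theorems.KolyvaginDepthDoor

open Literature.NumberTheory.EllipticCurves Literature.NumberTheory.EllipticCurves.ModularForms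
  WeierstrassCurve NumberField IsDedekindDomain
open Summit.BirchSwinnertonDyer.BirchSwinnertonDyer.Theorems
open Summit.BirchSwinnertonDyer.BirchSwinnertonDyer.Rank2Observatory
open Summit.BirchSwinnertonDyer.BirchSwinnertonDyer.Rank1Residual (IntModel.frobeniusTrace_eq)
open Summit.BirchSwinnertonDyer.Rank1Residual.Supersingular (natCard_point_eq_of_countPoints countPoints_eq_of_fast)
open Summit.BirchSwinnertonDyer.Rank1Residual.Additive (card_torsion_le_of_intModel_of_card
  isKolyvaginPrime_of_intModel_of_card)

namespace C794a1

/-- `#T̃₀(𝔽_197) = 210 = 7·30` for `T₀ = [1, 0, 1, -1334, -30036]` (`197 ≡ 1 (mod 7)`, `a_197(T₀) = -12 ≡ 2 (mod 7)`, `7² ∤ 210`),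
kernel-decided (`countPointsFast`). [cite: Kim2022StructureSelmer, §1.2.2 (PDF p. 5)] -/
theorem minTwist23_card_197 :
    Nat.card (((⟨1, 0, 1, -1334, -30036⟩ : WeierstrassCurve ℤ).map (Int.castRingHom (ZMod 197))).toAffine.Point) = 210 :=
  haveI : Fact (Nat.Prime 197) := ⟨by norm_num⟩
  natCard_point_eq_of_countPoints 1 0 1 (-1334) (-30036) 197 (by norm_num) (by decide +kernel) (n := 210)
    (countPoints_eq_of_fast (by decide +kernel))

/-- **`197` is a CYCLIC KOLYVAGIN PRIME for `(T₀, 7)`.** [cite: Kim2022StructureSelmer, §1.2.2 (PDF p. 5)] -/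
theorem minTwist23_isCyclicKolyvaginLevel_7_197 :
    haveI := minTwist23_isGloballyMinimal; haveI := Fact.mk (by norm_num : Nat.Prime 7);
    IsCyclicKolyvaginLevel ((⟨1, 0, 1, -1334, -30036⟩ : WeierstrassCurve ℤ).map (Int.castRingHom ℚ)) 7 197 := by
  haveI := minTwist23_isElliptic
  haveI := minTwist23_isGloballyMinimal
  haveI := Fact.mk (by norm_num : Nat.Prime 7)
  haveI : Fact (Nat.Prime 197) := ⟨by norm_num⟩
  have hℓ : Kato.IsKolyvaginPrime ((⟨1, 0, 1, -1334, -30036⟩ : WeierstrassCurve ℤ).map (Int.castRingHom ℚ)) 7 1 197 :=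
    isKolyvaginPrime_of_intModel_of_card minTwist23_intModel 7 1 197 (by norm_num) (by decide +kernel) (by decide)
      minTwist23_card_197 (by norm_num)
  refine ⟨⟨Nat.squarefree_iff_nodup_primeFactorsList (by norm_num) |>.mpr (by simp), fun ℓ hℓ' ↦ ?_⟩, fun ℓ hℓ' hdvd ↦ ?_⟩
  · rw [show (197 : ℕ).primeFactors = {197} from (Nat.Prime.primeFactors (by norm_num)), Finset.mem_singleton] at hℓ'
    exact hℓ' ▸ hℓ
  · obtain rfl := (Nat.prime_dvd_prime_iff_eq hℓ'.out (by norm_num)).mp hdvd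
    exact card_torsion_le_of_intModel_of_card minTwist23_intModel 7 197 minTwist23_card_197 (by norm_num)

/-- The integral point `P = (102, 896)` of `T₀ = [1, 0, 1, -1334, -30036]`. [folklore] -/
theorem minTwist23_nonsingular_P :
    ((⟨1, 0, 1, -1334, -30036⟩ : WeierstrassCurve ℤ).map (Int.castRingHom ℚ)).toAffine.Nonsingular ((102 : ℤ) : ℚ) ((896 : ℤ) : ℚ) :=
  nonsingular_rat_of_eq _ (by decide +kernel) (by norm_num)

/-- The double-and-add chain from `P̄` reaches the multiplier `30`. [folklore] -/
theorem chain197_mult :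
    chainMult 1 [(true, (123 : ZMod 197), (66 : ZMod 197)), (false, (171 : ZMod 197), (55 : ZMod 197)), (true, (100 : ZMod 197), (95 : ZMod 197)), (false, (93 : ZMod 197), (152 : ZMod 197)), (true, (75 : ZMod 197), (19 : ZMod 197)), (false, (32 : ZMod 197), (170 : ZMod 197)), (true, (8 : ZMod 197), (196 : ZMod 197))] = 30 := by
  decide

/-- The double-and-add chain from `P̄ = (102, 108)` to `30 • P̄ = (8, 196)` in `T̃₀(𝔽_197)` CHECKS (`decide`).
[cite: SilvermanAEC2009, III.2.3] -/
theorem chain197_ok :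
    chainB (⟨1, 0, 1, -1334, -30036⟩ : WeierstrassCurve ℤ) 197 (((102 : ℤ)) : ZMod 197) (((896 : ℤ)) : ZMod 197)
      ((((102 : ℤ)) : ZMod 197), (((896 : ℤ)) : ZMod 197))
      [(true, (123 : ZMod 197), (66 : ZMod 197)), (false, (171 : ZMod 197), (55 : ZMod 197)), (true, (100 : ZMod 197), (95 : ZMod 197)), (false, (93 : ZMod 197), (152 : ZMod 197)), (true, (75 : ZMod 197), (19 : ZMod 197)), (false, (32 : ZMod 197), (170 : ZMod 197)), (true, (8 : ZMod 197), (196 : ZMod 197))] = true := by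
  decide +kernel

/-- **KERNEL: `P = (102, 896)` is not divisible by `7` in `T₀(ℚ_197)`** (`30 • P̄ ≠ O` in `T̃₀(𝔽_197)`, `7·30 = #T̃₀(𝔽_197)`,
`localNondivisible_of_chainB`). [cite: SilvermanAEC2009, III.2.3, VII.2 Prop. 2.1, VII.3 Prop. 3.1] -/
theorem minTwist23_localNondivisible_197 :
    haveI : Fact (Nat.Prime 197) := ⟨by norm_num⟩;
    ∀ Q : (((⟨1, 0, 1, -1334, -30036⟩ : WeierstrassCurve ℤ).map (Int.castRingHom ℚ)).baseChange ℚ_[197]).toAffine.Point,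
      7 • Q ≠ WeierstrassCurve.Affine.Point.map (W' := ((⟨1, 0, 1, -1334, -30036⟩ : WeierstrassCurve ℤ).map (Int.castRingHom ℚ)).toAffine)
        (S := ℚ) (Algebra.ofId ℚ ℚ_[197]) (.some ((102 : ℤ) : ℚ) ((896 : ℤ) : ℚ) minTwist23_nonsingular_P) := by
  haveI : Fact (Nat.Prime 197) := ⟨by norm_num⟩
  have hq : ¬ ((197 : ℕ) : ℤ) ∣ (⟨1, 0, 1, -1334, -30036⟩ : WeierstrassCurve ℤ).Δ := by decide +kernel
  have hXY : (⟨1, 0, 1, -1334, -30036⟩ : WeierstrassCurve ℤ).toAffine.Equation (102) (896) :=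
    (Affine.equation_iff _ _).mpr (by norm_num)
  have hpk : 7 * 30 = Nat.card (((⟨1, 0, 1, -1334, -30036⟩ : WeierstrassCurve ℤ).map (Int.castRingHom (ZMod 197))).toAffine.Point) := by
    rw [minTwist23_card_197]
  exact localNondivisible_of_chainB (⟨1, 0, 1, -1334, -30036⟩ : WeierstrassCurve ℤ) 197 hq hXY minTwist23_nonsingular_P hpk
    chain197_mult (by convert chain197_ok)

/-- **ROW `794a1` @ `(7, -23)`: THE DECISIVE PRIME `197`, Selmer-bound form.** For every imaginary quadratic `K` with
`d_K = -23`, granted `hSak3` (Sakamoto 2022 L4.4 + L4.6 (1) by name): IF `#Sel_7(E^{(d_K)}/ℚ) ≤ 7` (the twist half of the row's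
depth-one bit), THEN every datum `D` of `T₀` at level `N_{T₀}` with `7 ∤ c_D` and the period transfer has a UNIT mod-`7` Kurihara number AT
`197` — the claim of a future tree record `cert_<T₀>` @ `(7, 197)`. Contrapositive: a computed ZERO at `197` certifies
`#Sel_7(E^{(d_K)}) > 7` modulo print. Side conditions all kernel (surjectivity / good ordinary at `7` of `E`, the twist's
non-anomaly and Kodaira–Néron at `7`, `197` cyclic Kolyvagin, the local certificate). CONDITIONAL on `hSak3`; per curve; BSD is not
proved by it. [cite: Sakamoto2022pSelmer, Lemma 4.4, Lemma 4.6 (1)] [cite: SilvermanAEC2009, X.5 Cor. 5.4] [cite: CremonaAlgorithms1997, Table 1 (794a1)] -/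
theorem twistKuriharaClaim_197_of_natCard_selmerGroup_le
    (hSak3 : Literature.NumberTheory.EllipticCurves.Sakamoto2022_kuriharaNumber_prime_ne_zero_of_localNondivisible)
    (K : Type) [Field K] [NumberField K] (hD : NumberField.discr K = -23)
    (hle : haveI := isElliptic_c794a1; haveI := isGloballyMinimal_c794a1; haveI := Fact.mk (by norm_num : Nat.Prime 7);
      Nat.card ((((⟨1, 0, 1, -3, 2⟩ : WeierstrassCurve ℤ).map (Int.castRingHom ℚ)).quadraticTwist (NumberField.discr K : ℚ)).selmerGroup (7 : ℕ)) ≤ 7) :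
    haveI := minTwist23_isElliptic; haveI := minTwist23_isGloballyMinimal;
    haveI : NeZero (((⟨1, 0, 1, -1334, -30036⟩ : WeierstrassCurve ℤ).map (Int.castRingHom ℚ)).conductorNorm ℤ) := neZero_conductorNorm_of_isElliptic _;
    haveI := Fact.mk (by norm_num : Nat.Prime 7);
    ∀ (D : ModularParametrizationData ((⟨1, 0, 1, -1334, -30036⟩ : WeierstrassCurve ℤ).map (Int.castRingHom ℚ)) (((⟨1, 0, 1, -1334, -30036⟩ : WeierstrassCurve ℤ).map (Int.castRingHom ℚ)).conductorNorm ℤ)),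
      ¬ ((7 : ℕ) : ℤ) ∣ D.maninConstant →
      (∃ u : ℚ, ‖(u : ℚ_[7])‖ = 1 ∧ ((⟨1, 0, 1, -1334, -30036⟩ : WeierstrassCurve ℤ).map (Int.castRingHom ℚ)).realPeriodRat = u * plusPeriod D.f) →
      ∃ ψ : (q : ℕ) → (ZMod q)ˣ →* Multiplicative (ZMod 7),
        (∀ q ∈ (197 : ℕ).primeFactors, Function.Surjective (ψ q)) ∧ kuriharaNumber D.f 7 197 ψ ≠ 0 := by
  haveI := isElliptic_c794a1
  haveI := isGloballyMinimal_c794a1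
  haveI := minTwist23_isElliptic
  haveI := minTwist23_isGloballyMinimal
  haveI iNZT : NeZero (((⟨1, 0, 1, -1334, -30036⟩ : WeierstrassCurve ℤ).map (Int.castRingHom ℚ)).conductorNorm ℤ) := neZero_conductorNorm_of_isElliptic _
  haveI iP := Fact.mk (by norm_num : Nat.Prime 7)
  haveI : Fact (Nat.Prime 197) := ⟨by norm_num⟩
  have hsur : ((⟨1, 0, 1, -3, 2⟩ : WeierstrassCurve ℤ).map (Int.castRingHom ℚ)).HasSurjectiveModNGaloisRep ((7 : ℕ) : ℤ) := by
    simpa using hasSurjectiveModNGaloisRep_7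
  have hC : (⟨1, (-2 : ℚ), -((1 : ℚ) / 2), (1 : ℚ) / 2⟩ : WeierstrassCurve.VariableChange ℚ) • ((⟨1, 0, 1, -1334, -30036⟩ : WeierstrassCurve ℤ).map (Int.castRingHom ℚ)) = ((⟨1, 0, 1, -3, 2⟩ : WeierstrassCurve ℤ).map (Int.castRingHom ℚ)).quadraticTwist ((NumberField.discr K : ℤ) : ℚ) := by
    rw [hD]; push_cast; exact minTwist23_smul_eq
  have hpD : ¬ (((7 : ℕ) : ℤ) ∣ NumberField.discr K) := by rw [hD]; decide
  intro D hc hu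
  exact twistKuriharaClaim_prime_of_natCard_selmerGroup_le hSak3 _ 7 (by norm_num) goodOrdinary_7.1 goodOrdinary_7.2 hsur
    (NumberField.discr_ne_zero K) hpD _ _ hC minTwist23_nonAnomalous_7 (minTwist23_kodairaNeron_of_five_le 7 (by norm_num)) hle 197
    minTwist23_isCyclicKolyvaginLevel_7_197 _ minTwist23_localNondivisible_197 D hc hu

end C794a1

end Summit.BirchSwinnertonDyer.BirchSwinnertonDyer.Theorems.KolyvaginDepthDoor

end
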